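/-
Copyright (c) 2026 the pub-hodgecm-mathlib formalisation cell (harness21).  Prover seat hodgecm-mathlib-F0P2-p02 (g14): road «S3-ram» (LEAD F0P3a-plan (g13); owner
F0P3a-p06 (g15); (Cnt2′) chair F0P3a-p07 (g14)), organ (z3)(c) kit — ROOT-TOKEN (eigenframe-free) forms of ★ S1 and ★ ORIENTATION; 2026-09-02.
Text = ★ `UnitaryLatticeTreeRegionUpClosedRamified` §4∕§5 `_of_neg` heads (F0P3-p04 (g14)) with the eigenframe binders replaced by the root token `hroot`.
-/
import Literature.NumberTheory.Automorphic.UnitaryLatticeTreeRegionUpClosedRamified   -- ★ S1 + ORIENTATION, frames forms (F0P3-p04 (g14))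
import HarnessLib

/-!
# The lattice graph of a hermitian space — `LEV(ϖ^d)` IS UP-CLOSED and ORIENTATION, from the ROOT TOKEN alone (eigenframe-free forms for type-(2) literals)
# (Bruhat–Tits 1972 §10; Serre, *Trees* II.1.1; Kottwitz 1986 §3)

Topic `NumberTheory/Automorphic`; namespace `Literature.NumberTheory.Automorphic.UnitaryLatticeTree`.  THEOREMS ONLY (no definition, no instance, no notation, no named fact,
no `sorry`); kernel lane `--supports stmt-HodgeConjecture-24833`.  Cell `pub/hodgecm-mathlib` (D-0151), crux H413; road «S3-ram» (Literature seeding, count-neutral); the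
(Cnt2′) type-(2) assembly of chair F0P3a-p07 (g14), organ (z3)(c) (the rows below the axis need `horient` and the region needs `hRup` for a literal WITHOUT a `K`-eigenframe).

WHY THIS FILE.  ★ `UnitaryLatticeTreeRegionUpClosedRamified` (F0P3-p04) proves S1 «`LEV(ϖ^{d₀})` is up-closed towards the root» and the ORIENTATION clause in a FRAMES form
(`map_sub_one_le_scaleLattice_of_grandchild_of_frames`, `exists_parent_grandparent_lev_of_frames`: hypotheses = the frame dischargers + the root token `hroot : LEV[r₀](c)`) and
then, in the tame-ramified `_of_neg` forms, discharges the frames AND derives `hroot` from the junction's eigenframe `γ = A·diag(s)·A⁻¹`.  The type-(2) literals `ι(γ₂, u)` of the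
(Cnt2′) tube have no `K`-eigenframe but do carry the root token at the centre of their axis (`|Γ − 1| ≤ |ϖ|^D` there).  THIS FILE files the two `_of_neg` heads with the frames
discharged (verbatim ★ proofs) and `hroot` KEPT as the hypothesis: **`row_regionUpClosed_of_root`** and **`exists_parent_grandparent_lev_of_root`**.

HONEST LABEL: HC_CM is proved only modulo the 2 remaining named inputs (hLiu418 24832, h413 24833) until rung 0 closes; nothing printed is asserted here (lattice bookkeeping).

## References
* [BruhatTits1972] F. Bruhat, J. Tits, *Groupes réductifs sur un corps local I*, Publ. Math. IHÉS 41 (1972), §10.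
* [Serre1980Trees] J.-P. Serre, *Trees* (1980), Ch. I §2.3, Ch. II §1.1.
* [Kottwitz1986] R. E. Kottwitz, *Base change for unit elements of Hecke algebras*, Compositio Math. 60 (1986), §3.
* [Tits1979] J. Tits, *Reductive groups over local fields*, PSPM 33.1 (1979), §2.4, §3.5.
-/

set_option autoImplicit false

noncomputable section

open scoped Valued WithZero Matrix MatrixGroups

namespace Literature.NumberTheory.Automorphic.UnitaryLatticeTree

open Literature.NumberTheory.Automorphic Literature.NumberTheory.Automorphic.HermitianLattice
open Literature.NumberTheory.Automorphic.CartanUnique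

variable {K : Type*} [Field K] [Valued K ℤᵐ⁰] {σ : K →+* K} {ϖ : K}

/-! ## §1 S1 from the root token -/

/-- **S1 «THE REGION IS UP-CLOSED», ROOT-TOKEN FORM (eigenframe-free).**  ★ `row_regionUpClosed_of_neg` with the eigenframe ∕ isoceles binders
`(d hd hdσ A hA hA' hdA s hs1 hsv hsσ hγA i₀ hd3 he hiso hclose)` replaced by the ONE hypothesis they served: the root token `hroot : LEV[r₀](ϖ^{d₀})`.  For any `γ ∈ U(J₀)`
(e.g. a type-(2) literal `ι(γ₂, u)` framed to the centre of its axis, which has no `K`-eigenframe): a fixed self-dual `v` with a fixed self-dual grandchild `w` (two steps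
further from `r₀`) carrying `LEV[w](ϖ^{d₀})` has `LEV[v](ϖ^{d₀})`. [cite: Kottwitz1986, §3] [cite: BruhatTits1972, §10] [cite: Serre1980Trees, II.1.1] [cite: Tits1979, §2.4, §3.5] -/
theorem row_regionUpClosed_of_root (hσ : ∀ x, σ (σ x) = x) (hvσ : ∀ a, Valued.v (σ a) = Valued.v a) (hσϖ : σ ϖ = -ϖ)
    (hϖ : Valued.v ϖ = WithZero.exp (-1 : ℤ)) (hres : ∀ x : K, Valued.v x ≤ 1 → Valued.v (σ x - x) < 1) (h2 : Valued.v (2 : K) = 1)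
    (hnorm : ∀ u : K, σ u = u → Valued.v (u - 1) < 1 → ∃ z : K, z * σ z = u ∧ Valued.v (z - 1) ≤ Valued.v (u - 1)) [Finite 𝓀[K]]
    [ValuativeRel K] [(Valued.v : Valuation K ℤᵐ⁰).Compatible]
    (_hT : (latticeGraph σ ϖ ((StdForm.antidiagonal 3).over K)).IsTree)
    {γ : unitaryGroupOfForm σ ((StdForm.antidiagonal 3).over K)} (_hγ0 : γ ∈ unitaryInt σ ((StdForm.antidiagonal 3).over K))
    {d₀ : ℕ} (hroot : (stdLattice K 3).map ((Matrix.toLin' (((γ : GL (Fin 3) K) : Matrix (Fin 3) (Fin 3) K) - 1)).restrictScalars 𝒪[K]) ≤ scaleLattice (ϖ ^ d₀) (stdLattice K 3))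
    {v : {M : Submodule 𝒪[K] (Fin 3 → K) // IsVertex σ ϖ ((StdForm.antidiagonal 3).over K) M}} (hv : IsSelfDualLattice σ ϖ ((StdForm.antidiagonal 3).over K) v.1) (_hfix : latticeGraphIso σ ϖ ((StdForm.antidiagonal 3).over K) γ v = v)
    {w : {M : Submodule 𝒪[K] (Fin 3 → K) // IsVertex σ ϖ ((StdForm.antidiagonal 3).over K) M}} (hw : w ∈ {w | ∃ c, ((latticeGraph σ ϖ ((StdForm.antidiagonal 3).over K)).Adj v c ∧ (latticeGraph σ ϖ ((StdForm.antidiagonal 3).over K)).dist ⟨stdLattice K 3, 0, isSelfDualLattice_stdLattice_three_of_v hϖ⟩ c = (latticeGraph σ ϖ ((StdForm.antidiagonal 3).over K)).dist ⟨stdLattice K 3, 0, isSelfDualLattice_stdLattice_three_of_v hϖ⟩ v + 1 ∧ latticeGraphIso σ ϖ ((StdForm.antidiagonal 3).over K) γ c = c) ∧ ((latticeGraph σ ϖ ((StdForm.antidiagonal 3).over K)).Adj c w ∧ (latticeGraph σ ϖ ((StdForm.antidiagonal 3).over K)).dist ⟨stdLattice K 3, 0, isSelfDualLattice_stdLattice_three_of_v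 hϖ⟩ w = (latticeGraph σ ϖ ((StdForm.antidiagonal 3).over K)).dist ⟨stdLattice K 3, 0, isSelfDualLattice_stdLattice_three_of_v hϖ⟩ c + 1 ∧ latticeGraphIso σ ϖ ((StdForm.antidiagonal 3).over K) γ w = w)})
    (hwR : w.1.map ((Matrix.toLin' (((γ : GL (Fin 3) K) : Matrix (Fin 3) (Fin 3) K) - 1)).restrictScalars 𝒪[K]) ≤ scaleLattice (ϖ ^ d₀) w.1) :
    v.1.map ((Matrix.toLin' (((γ : GL (Fin 3) K) : Matrix (Fin 3) (Fin 3) K) - 1)).restrictScalars 𝒪[K]) ≤ scaleLattice (ϖ ^ d₀) v.1 := by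
  have hϖ0 : ϖ ≠ 0 := uniformizer_ne_zero hϖ
  have hc : ϖ ^ d₀ ≠ 0 := pow_ne_zero _ hϖ0
  refine map_sub_one_le_scaleLattice_of_grandchild_of_frames hσ hvσ hϖ (fun L hL => ?_) (fun M hM => ?_) hc hroot hv hw hwR
  · obtain ⟨u, rfl⟩ := exists_unitary_mapGL_stdLattice_eq_of_isSelfDualLattice_of_v_two hσ hvσ hϖ h2 hL
    exact exists_frame_mapGL_stdLattice hσ hvσ hϖ u
  · obtain ⟨u, rfl⟩ := forall_isVertexLattice_two_exists_mapGL_N₁_eq_of_neg hσ hvσ hϖ hσϖ hres h2 hnorm M hM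
    exact exists_frame_mapGL_N₁ hσ hvσ hϖ u

/-! ## §2 Orientation from the root token -/

section Orientation

open scoped Classical

/-- **ORIENTATION, ROOT-TOKEN FORM (eigenframe-free).**  ★ `exists_parent_grandparent_lev_of_neg` with `(A hA hA' s hγA he)` replaced by `hroot : LEV[r₀](ϖ^e)`: for
`γ ∈ K₀` and a fixed self-dual `v ≠ r₀` with `LEV[v](ϖ^e)` there are the inward neighbour `p` and a far vertex `g ≠ v` through `p` with `LEV[g](ϖ^e)` — the `horient`
binder of the ★ engine rows (`engineRows_of_rows_of_nilToken` ∕ `_of_charpoly_block`) at `e := dep v`, for literals without a `K`-eigenframe.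
[cite: Serre1980Trees, I.2.3, II.1.1] [cite: Kottwitz1986, §3] [cite: Tits1979, §3.5] -/
theorem exists_parent_grandparent_lev_of_root (hσ : ∀ x, σ (σ x) = x) (hvσ : ∀ a, Valued.v (σ a) = Valued.v a) (hσϖ : σ ϖ = -ϖ)
    (hϖ : Valued.v ϖ = WithZero.exp (-1 : ℤ)) (hres : ∀ x : K, Valued.v x ≤ 1 → Valued.v (σ x - x) < 1) (h2 : Valued.v (2 : K) = 1)
    (hnorm : ∀ u : K, σ u = u → Valued.v (u - 1) < 1 → ∃ z : K, z * σ z = u ∧ Valued.v (z - 1) ≤ Valued.v (u - 1))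
    [ValuativeRel K] [(Valued.v : Valuation K ℤᵐ⁰).Compatible]
    (hT : (latticeGraph σ ϖ ((StdForm.antidiagonal 3).over K)).IsTree)
    {γ : unitaryGroupOfForm σ ((StdForm.antidiagonal 3).over K)} (hγ0 : γ ∈ unitaryInt σ ((StdForm.antidiagonal 3).over K))
    {e : ℕ} (hroot : (stdLattice K 3).map ((Matrix.toLin' (((γ : GL (Fin 3) K) : Matrix (Fin 3) (Fin 3) K) - 1)).restrictScalars 𝒪[K]) ≤ scaleLattice (ϖ ^ e) (stdLattice K 3))
    {v : {M : Submodule 𝒪[K] (Fin 3 → K) // IsVertex σ ϖ ((StdForm.antidiagonal 3).over K) M}} (hv : IsSelfDualLattice σ ϖ ((StdForm.antidiagonal 3).over K) v.1)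
    (hvr : v ≠ ⟨stdLattice K 3, 0, isSelfDualLattice_stdLattice_three_of_v hϖ⟩) (hfix : latticeGraphIso σ ϖ ((StdForm.antidiagonal 3).over K) γ v = v)
    (hlev : v.1.map ((Matrix.toLin' (((γ : GL (Fin 3) K) : Matrix (Fin 3) (Fin 3) K) - 1)).restrictScalars 𝒪[K]) ≤ scaleLattice (ϖ ^ e) v.1) :
    ∃ p g : {M : Submodule 𝒪[K] (Fin 3 → K) // IsVertex σ ϖ ((StdForm.antidiagonal 3).over K) M},
      (latticeGraph σ ϖ ((StdForm.antidiagonal 3).over K)).Adj v p ∧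
      (latticeGraph σ ϖ ((StdForm.antidiagonal 3).over K)).dist ⟨stdLattice K 3, 0, isSelfDualLattice_stdLattice_three_of_v hϖ⟩ p + 1 =
        (latticeGraph σ ϖ ((StdForm.antidiagonal 3).over K)).dist ⟨stdLattice K 3, 0, isSelfDualLattice_stdLattice_three_of_v hϖ⟩ v ∧
      (latticeGraph σ ϖ ((StdForm.antidiagonal 3).over K)).Adj p g ∧ g ≠ v ∧
      g.1.map ((Matrix.toLin' (((γ : GL (Fin 3) K) : Matrix (Fin 3) (Fin 3) K) - 1)).restrictScalars 𝒪[K]) ≤ scaleLattice (ϖ ^ e) g.1 := by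
  have hϖ0 : ϖ ≠ 0 := uniformizer_ne_zero hϖ
  have hc : ϖ ^ e ≠ 0 := pow_ne_zero _ hϖ0
  have hγr : latticeGraphIso σ ϖ ((StdForm.antidiagonal 3).over K) γ ⟨stdLattice K 3, 0, isSelfDualLattice_stdLattice_three_of_v hϖ⟩ = ⟨stdLattice K 3, 0, isSelfDualLattice_stdLattice_three_of_v hϖ⟩ :=
    (latticeGraphIso_eq_iff_mapGL_eq γ _).2 (mapGL_stdLattice_of_mem_unitaryInt hγ0)
  refine exists_parent_grandparent_lev_of_frames hσ hvσ hϖ (fun L hL => ?_) (fun M hM => ?_) hT hγr hc hroot hv hvr hfix hlev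
  · obtain ⟨u, rfl⟩ := exists_unitary_mapGL_stdLattice_eq_of_isSelfDualLattice_of_v_two hσ hvσ hϖ h2 hL
    exact exists_frame_mapGL_stdLattice hσ hvσ hϖ u
  · obtain ⟨u, rfl⟩ := forall_isVertexLattice_two_exists_mapGL_N₁_eq_of_neg hσ hvσ hϖ hσϖ hres h2 hnorm M hM
    exact exists_frame_mapGL_N₁ hσ hvσ hϖ u

end Orientation

end Literature.NumberTheory.Automorphic.UnitaryLatticeTree

end
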